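import Literature.NumberTheory.LFunctions.MoebiusWalshCircuits
import Literature.Computability.Complexity.ACFourierTails
import Mathlib.Data.Nat.Choose.Bounds
import HarnessLib

/-!
# Green 2012, Theorem 1 from Proposition 1 (the `AC⁰(d)` layer of `MoebiusWalshCircuits`, proved)

Topic `Literature/NumberTheory/LFunctions`; a proofs companion of `MoebiusWalshCircuits.lean`
(theorems only, no definition, no named fact), next to `MoebiusWalshCircuitsProofs.lean`
(Bourgain 2013, §1) and `MoebiusWalshDyadic.lean` (Green 2012, §4 Lemma 1).

B. Green, *On (not) computing the Möbius function using bounded depth circuits*, Combin. Probab.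
Comput. 21 (2012) 942–951 (= arXiv:1103.4991) [Green2012], proves Theorem 1 (`μ` is orthogonal to
`AC⁰(d)` functions; the named fact `green_moebius_ACd` of `MoebiusWalshCircuits.lean`) in two steps:
Proposition 1 (the Fourier–Walsh coefficients `μ̂(S)`, `|S| = k ≥ 1`, are `O(k e^{-c√n/k})`; the
named fact `green_moebius_fourierWalsh`, whose proof is the analytic heart of the paper — Kátai's
smoothing, the prime number theorem for `μχ` modulo powers of two with the classical error term,
Vaughan-type minor-arc estimates and a diophantine lemma of Harman–Kátai — and is NOT formalised
here) and a short deduction, §2 of the paper: Parseval on the cube, the trivial bound `|F̂(S)| ≤ 1`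
on the `≤ n^{1/6}` levels, Cauchy–Schwarz and the Linial–Mansour–Nisan Fourier-tail bound above.

This file formalises that deduction, i.e. proves

* `green_moebius_ACd_of_fourierWalsh : green_moebius_fourierWalsh → green_moebius_ACd`,
* `green_liouville_ACd_of_fourierWalsh : green_liouville_fourierWalsh → green_liouville_ACd`,

so that discharging Proposition 1 (resp. its `λ` twin) discharges Theorem 1 (resp. its `λ` twin,
the fact consumed by route `PneNP/Mobius`) by a one-line application.

## The argument (Green 2012, §2) and where we deviate

For a circuit `C` on `n` digits let `F = sgn ∘ C.eval ∈ {±1}` and `G(x) = g(val x)`,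
`val x = Σ_j x_j 2^j`; then `corr(g, C)/2ⁿ = -Σ_S Ĝ(S) F̂(S)` (`Green2012.circuitCorrelation_eq`,
Parseval/inversion from `BooleanFourier.lean`). With `k₀ = ⌊n^{1/6}⌋`:
`|Σ_S Ĝ F̂| ≤ #{S : |S| ≤ k₀} · max_{|S| ≤ k₀} |Ĝ(S)| + R`, `R = Σ_{|S| > k₀} |Ĝ||F̂|`,
`R² ≤ W^{>k₀}[F]` (Cauchy–Schwarz, `Σ_S Ĝ(S)² ≤ 1`), and `#{|S| ≤ k₀} ≤ (k₀+1) n^{k₀}`.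

* In place of Linial–Mansour–Nisan (Green's Theorem 2) we use the tree's PROVED bound of Tal
  (`ACForm.tailWeight_le_tailBound` with `Circuit.exists_acForm`, file `ACFourierTails.lean`):
  `W^{≥k}[F] ≤ 8^{d+1} 2^{-k/(16896^{d+1} ℓ^{d-1})}`, `ℓ = ⌊log₂(2nᵈ+1)⌋ ≤ 5 d ln n`
  (`Green2012.tailWeight_circuit_le`). Its shape differs from LMN's `2M·2^{-t^{1/d}/20}`; the
  bookkeeping `Green2012.tail_numeric` shows it still yields `O(e^{d log n - c' n^{1/(6d)}})`
  (with `c' = min(c/2, 1/(6·16896²))`; in the regime `c' n^{1/(6d)} ≤ (d log n)/2` or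
  `n^{1/(6d)} ≤ e` the claimed bound is `≥ R` trivially since `R ≤ 1`).
* The printed §2 tacitly needs the constant coefficient `μ̂(∅) = (Σ_{x<2ⁿ} μ(x))/2ⁿ` to be small,
  which is the prime number theorem with an error term and is not part of Proposition 1 (stated
  for `|S| = k ≥ 1`). We avoid it: `μ̂ₙ(∅) + μ̂ₙ({0}) + μ̂ₙ({1}) + μ̂ₙ({0,1}) = 0` termwise
  (`Green2012.moebius_walshSum_empty_identity`: a factor `1 + χ` vanishes unless `x₀ = x₁ = 0`, and
  then `4 ∣ val x`, `μ(val x) = 0`), and for `λ` the two digit identities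
  `λ̂ₙ₊₁(∅) + λ̂ₙ₊₁({0}) = -2λ̂ₙ(∅)·(2ⁿ/2ⁿ⁺¹)`-type relations from `λ(2m) = -λ(m)`
  (`Green2012.liouville_walshSum_cons_identity`, `…_snoc_identity`) give `λ̂ₙ(∅)` from the
  coefficients at `{0}` and `{n}` one level up. So the deduction uses Proposition 1 ONLY.
* Small `n` (`n^{1/6} < 576/c²`) are covered by `|corr|/2ⁿ ≤ 1` and the choice of the constant.

Everything here is proved; no new named fact is introduced. The main estimate is stated once for a
general `g : ℕ → ℤ` with `|g| ≤ 1` (`Green2012.acd_of_walsh_bounds`) and specialised to `μ` and `λ`.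

## References

* B. Green, *On (not) computing the Möbius function using bounded depth circuits*, Combin. Probab.
  Comput. 21 (2012), §2 [Green2012].
* A. Tal, *Tight bounds on the Fourier spectrum of AC⁰*, CCC 2017, Thm. 3.6 [Tal2017].
* R. O'Donnell, *Analysis of Boolean Functions*, CUP 2014, §1.4 [ODonnell2014].
-/

noncomputable section

namespace Literature.NumberTheory.LFunctions

open Finset
open Literature.Computability.Complexity
open Literature.Computability.Complexity.LowDegree (cubeFourierCoeff tailWeight sum_cubeFourierCoeff_mul_walsh
  sum_cubeFourierCoeff_sq abs_cubeFourierCoeff_le_one tailWeight_le_one)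
open Literature.Probability.RandomGraphs.LowDegree (walsh sgn)

namespace Green2012

variable {n : ℕ}

/-! ### The correlation as a sum over the Walsh spectrum -/

/-- `walshSum g A = Σ_x g(val x) χ_A(x)` with the tree's Walsh character `walsh`; throughout,
`g` is read on the cube `{0,1}ⁿ` through `val x = Σ_j x_j 2^j = bitsToNat (List.ofFn x)`. [folklore] -/
theorem walshSum_eq (g : ℕ → ℤ) (A : Finset (Fin n)) :
    walshSum g A = ∑ x, (g (bitsToNat (List.ofFn x)) : ℝ) * walsh A x := rfl

/-- `walshSum g A / 2ⁿ` is the cube Fourier coefficient `ĝ(A)` of `BooleanFourier.lean`. [folklore] -/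
theorem walshSum_div_eq (g : ℕ → ℤ) (A : Finset (Fin n)) :
    walshSum g A / 2 ^ n = cubeFourierCoeff (fun x : Fin n → Bool => (g (bitsToNat (List.ofFn x)) : ℝ)) A := rfl

/-- The sign convention of `circuitCorrelation` is `-sgn`. [folklore] -/
theorem neg_sgn_eq (b : Bool) : -sgn b = (if b = true then (1 : ℝ) else -1) := by
  cases b <;> simp [sgn]

/-- **Parseval step** (Green 2012, §2, first display): `corr(g, C) = -2ⁿ Σ_S ĝ(S) F̂(S)` with
`F = sgn ∘ C.eval`. [cite: Green2012, §2] -/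
theorem circuitCorrelation_eq (g : ℕ → ℤ) (C : Circuit (Fin n)) :
    circuitCorrelation g C =
      -(2 ^ n * ∑ S, cubeFourierCoeff (fun x : Fin n → Bool => (g (bitsToNat (List.ofFn x)) : ℝ)) S *
        cubeFourierCoeff (fun x => sgn (C.eval x)) S) := by
  have h1 : circuitCorrelation g C = -∑ x, (g (bitsToNat (List.ofFn x)) : ℝ) * sgn (C.eval x) := by
    rw [circuitCorrelation, ← Finset.sum_neg_distrib]
    refine Finset.sum_congr rfl fun x _ => ?_
    rw [← neg_sgn_eq]; ring
  rw [h1]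
  congr 1
  have h2 : ∀ x : Fin n → Bool, (g (bitsToNat (List.ofFn x)) : ℝ) * sgn (C.eval x) =
      ∑ S, cubeFourierCoeff (fun x => sgn (C.eval x)) S * ((g (bitsToNat (List.ofFn x)) : ℝ) * walsh S x) := by
    intro x
    conv_lhs => rw [← sum_cubeFourierCoeff_mul_walsh (fun x => sgn (C.eval x)) x]
    rw [Finset.mul_sum]
    exact Finset.sum_congr rfl fun S _ => by ring
  simp_rw [h2]
  rw [Finset.sum_comm, Finset.mul_sum]
  refine Finset.sum_congr rfl fun S _ => ?_
  rw [← Finset.mul_sum, cubeFourierCoeff, cubeFourierCoeff]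
  have h2n : (2 : ℝ) ^ n ≠ 0 := by positivity
  field_simp

/-- The normalised correlation is `|Σ_S ĝ(S) F̂(S)|`. [cite: Green2012, §2] -/
theorem abs_circuitCorrelation_div_eq (g : ℕ → ℤ) (C : Circuit (Fin n)) :
    |circuitCorrelation g C| / 2 ^ n =
      |∑ S, cubeFourierCoeff (fun x : Fin n → Bool => (g (bitsToNat (List.ofFn x)) : ℝ)) S *
        cubeFourierCoeff (fun x => sgn (C.eval x)) S| := by
  rw [circuitCorrelation_eq, abs_neg, abs_mul, abs_of_pos (by positivity : (0 : ℝ) < 2 ^ n)]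
  have h2n : (0 : ℝ) < 2 ^ n := by positivity
  field_simp

/-- Trivial bound `|corr(g, C)| / 2ⁿ ≤ 1` for `|g| ≤ 1`. [folklore] -/
theorem abs_circuitCorrelation_div_le_one (g : ℕ → ℤ) (hg : ∀ m, |g m| ≤ 1) (C : Circuit (Fin n)) :
    |circuitCorrelation g C| / 2 ^ n ≤ 1 := by
  rw [div_le_one (by positivity), circuitCorrelation]
  calc |∑ x : Fin n → Bool, (g (bitsToNat (List.ofFn x)) : ℝ) * (if C.eval x = true then (1 : ℝ) else -1)|
      ≤ ∑ x : Fin n → Bool, |(g (bitsToNat (List.ofFn x)) : ℝ) * (if C.eval x = true then (1 : ℝ) else -1)| :=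
        Finset.abs_sum_le_sum_abs _ _
    _ ≤ ∑ _x : Fin n → Bool, (1 : ℝ) := by
        refine Finset.sum_le_sum fun x _ => ?_
        rw [abs_mul]
        have h1 : |(g (bitsToNat (List.ofFn x)) : ℝ)| ≤ 1 := by exact_mod_cast hg _
        have h2 : |(if C.eval x = true then (1 : ℝ) else -1)| = 1 := by split_ifs <;> simp
        rw [h2, mul_one]; exact h1
    _ = 2 ^ n := by simp

/-! ### Splitting the spectrum at level `k₀` -/

/-- The high part `R = Σ_{|S| ≥ k} |Ĝ(S)| |F̂(S)|` is nonnegative. [folklore] -/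
theorem hiPart_nonneg (G F : (Fin n → Bool) → ℝ) (k : ℕ) :
    0 ≤ ∑ S ∈ univ.filter (fun S : Finset (Fin n) => k ≤ S.card), |cubeFourierCoeff G S| * |cubeFourierCoeff F S| :=
  Finset.sum_nonneg fun _ _ => mul_nonneg (abs_nonneg _) (abs_nonneg _)

/-- **Low/high split** (Green 2012, §2, second display): with `|F̂| ≤ 1` and `|Ĝ(S)| ≤ B` on the
levels `≤ k₀`, `|Σ_S Ĝ F̂| ≤ #{S : |S| ≤ k₀} · B + R`. [cite: Green2012, §2] -/
theorem abs_sum_coeff_mul_le (G F : (Fin n → Bool) → ℝ) (k₀ : ℕ) {B : ℝ}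
    (hF : ∀ x, |F x| ≤ 1) (hB : ∀ S : Finset (Fin n), S.card ≤ k₀ → |cubeFourierCoeff G S| ≤ B) :
    |∑ S, cubeFourierCoeff G S * cubeFourierCoeff F S| ≤
      ((univ.filter (fun S : Finset (Fin n) => S.card ≤ k₀)).card : ℝ) * B +
        ∑ S ∈ univ.filter (fun S : Finset (Fin n) => k₀ + 1 ≤ S.card), |cubeFourierCoeff G S| * |cubeFourierCoeff F S| := by
  calc |∑ S, cubeFourierCoeff G S * cubeFourierCoeff F S|
      ≤ ∑ S, |cubeFourierCoeff G S * cubeFourierCoeff F S| := Finset.abs_sum_le_sum_abs _ _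
    _ = ∑ S, |cubeFourierCoeff G S| * |cubeFourierCoeff F S| := by simp_rw [abs_mul]
    _ = (∑ S ∈ univ.filter (fun S : Finset (Fin n) => S.card ≤ k₀), |cubeFourierCoeff G S| * |cubeFourierCoeff F S|) +
          ∑ S ∈ univ.filter (fun S : Finset (Fin n) => k₀ + 1 ≤ S.card),
            |cubeFourierCoeff G S| * |cubeFourierCoeff F S| := by
        rw [← Finset.sum_filter_add_sum_filter_not univ (fun S : Finset (Fin n) => S.card ≤ k₀)]
        congr 1
        refine Finset.sum_congr ?_ fun _ _ => rfl
        ext S; simp only [Finset.mem_filter, Finset.mem_univ, true_and]; omega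
    _ ≤ (∑ S ∈ univ.filter (fun S : Finset (Fin n) => S.card ≤ k₀), B) +
          ∑ S ∈ univ.filter (fun S : Finset (Fin n) => k₀ + 1 ≤ S.card),
            |cubeFourierCoeff G S| * |cubeFourierCoeff F S| := by
        gcongr with S hS
        · simp only [Finset.mem_filter, Finset.mem_univ, true_and] at hS
          calc |cubeFourierCoeff G S| * |cubeFourierCoeff F S| ≤ |cubeFourierCoeff G S| * 1 :=
                mul_le_mul_of_nonneg_left (abs_cubeFourierCoeff_le_one F hF S) (abs_nonneg _)
            _ ≤ B := by rw [mul_one]; exact hB S hS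
    _ = _ := by rw [Finset.sum_const, nsmul_eq_mul]

/-- **Cauchy–Schwarz and Parseval for the high part** (Green 2012, §2, third display):
`R² ≤ W^{≥k}[F]` when `Σ_S Ĝ(S)² = 𝔼 G² ≤ 1`. [cite: Green2012, §2] -/
theorem hiPart_sq_le (G F : (Fin n → Bool) → ℝ) (hG : ∀ x, G x ^ 2 ≤ 1) (k : ℕ) :
    (∑ S ∈ univ.filter (fun S : Finset (Fin n) => k ≤ S.card), |cubeFourierCoeff G S| * |cubeFourierCoeff F S|) ^ 2 ≤
      tailWeight F k := by
  have hcs := Finset.sum_mul_sq_le_sq_mul_sq (univ.filter (fun S : Finset (Fin n) => k ≤ S.card))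
    (fun S => |cubeFourierCoeff G S|) (fun S => |cubeFourierCoeff F S|)
  refine hcs.trans ?_
  simp only [sq_abs]
  have hG1 : ∑ S ∈ univ.filter (fun S : Finset (Fin n) => k ≤ S.card), cubeFourierCoeff G S ^ 2 ≤ 1 := by
    calc ∑ S ∈ univ.filter (fun S : Finset (Fin n) => k ≤ S.card), cubeFourierCoeff G S ^ 2
        ≤ ∑ S, cubeFourierCoeff G S ^ 2 :=
          Finset.sum_le_sum_of_subset_of_nonneg (Finset.subset_univ _) fun _ _ _ => sq_nonneg _
      _ = (∑ x, G x ^ 2) / 2 ^ n := sum_cubeFourierCoeff_sq G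
      _ ≤ (∑ _x : Fin n → Bool, (1 : ℝ)) / 2 ^ n := by gcongr with x _; exact hG x
      _ = 1 := by simp
  calc (∑ S ∈ univ.filter (fun S : Finset (Fin n) => k ≤ S.card), cubeFourierCoeff G S ^ 2) *
        (∑ S ∈ univ.filter (fun S : Finset (Fin n) => k ≤ S.card), cubeFourierCoeff F S ^ 2)
      ≤ 1 * tailWeight F k :=
        mul_le_mul hG1 le_rfl (Finset.sum_nonneg fun _ _ => sq_nonneg _) zero_le_one
    _ = tailWeight F k := one_mul _

/-- Consequently `R ≤ 1` for `{±1}`-valued `F`. [folklore] -/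
theorem hiPart_le_one (G F : (Fin n → Bool) → ℝ) (hG : ∀ x, G x ^ 2 ≤ 1) (hF : ∀ x, F x ^ 2 = 1) (k : ℕ) :
    ∑ S ∈ univ.filter (fun S : Finset (Fin n) => k ≤ S.card), |cubeFourierCoeff G S| * |cubeFourierCoeff F S| ≤ 1 := by
  have h := (hiPart_sq_le G F hG k).trans (tailWeight_le_one hF k)
  nlinarith [hiPart_nonneg G F k]

/-- Counting the low levels: `#{S ⊆ [n] : |S| ≤ k} ≤ (k+1) nᵏ` for `n ≥ 1` (Green counts
`n^{n^{1/6}}`). [folklore] -/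
theorem card_filter_card_le (hn : 1 ≤ n) (k : ℕ) :
    ((univ.filter (fun S : Finset (Fin n) => S.card ≤ k)).card : ℝ) ≤ (k + 1) * (n : ℝ) ^ k := by
  have hsub : univ.filter (fun S : Finset (Fin n) => S.card ≤ k) ⊆
      (Finset.range (k + 1)).biUnion (fun j => univ.powersetCard j) := by
    intro S hS
    simp only [Finset.mem_filter, Finset.mem_univ, true_and] at hS
    simp only [Finset.mem_biUnion, Finset.mem_range, Finset.mem_powersetCard]
    exact ⟨S.card, by omega, Finset.subset_univ _, rfl⟩
  have h1 : ((univ.filter (fun S : Finset (Fin n) => S.card ≤ k)).card : ℝ) ≤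
      ∑ j ∈ Finset.range (k + 1), ((((univ : Finset (Fin n)).powersetCard j).card : ℕ) : ℝ) := by
    have := (Finset.card_le_card hsub).trans Finset.card_biUnion_le
    exact_mod_cast this
  refine h1.trans ?_
  calc (∑ j ∈ Finset.range (k + 1), ((((univ : Finset (Fin n)).powersetCard j).card : ℕ) : ℝ))
      ≤ ∑ _j ∈ Finset.range (k + 1), (n : ℝ) ^ k := by
        refine Finset.sum_le_sum fun j hj => ?_
        rw [Finset.mem_range] at hj
        rw [Finset.card_powersetCard, Finset.card_univ, Fintype.card_fin]
        calc ((n.choose j : ℕ) : ℝ) ≤ (n : ℝ) ^ j := by exact_mod_cast Nat.choose_le_pow n j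
          _ ≤ (n : ℝ) ^ k := pow_le_pow_right₀ (by exact_mod_cast hn) (by omega)
    _ = (k + 1) * (n : ℝ) ^ k := by rw [Finset.sum_const, Finset.card_range, nsmul_eq_mul]; push_cast; ring

/-- **Tal's Theorem 3.6 for circuits over `acBasis` with every gate counted in the depth** (the
tree's replacement for Green's Theorem 2 = Linial–Mansour–Nisan): a circuit of depth `≤ d`
(`d ≥ 1`) and size `≤ s` has `W^{≥k}[sgn ∘ C] ≤ 8^{d+1} exp(-k ln 2 / (B^{d+1} ℓ^{d-1}))`,
`ℓ = ⌊log₂(2s+1)⌋`, `B = 16896` — from `Circuit.exists_acForm` (height `≤ acDepth + 1 ≤ depth + 1`,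
width `1`, effective size `≤ 2s`) and `ACForm.tailWeight_le_tailBound`. [cite: Tal2017, Theorem 3.6] -/
theorem tailWeight_circuit_le (C : Circuit (Fin n)) (hC : C.IsOver acBasis) {d s : ℕ}
    (hd1 : 1 ≤ d) (hd : C.depth ≤ d) (hs : C.size ≤ s) (h1 : 1 ≤ s) (k : ℕ) :
    tailWeight (fun x => sgn (C.eval x)) k ≤
      (ACForm.cA : ℝ) ^ (d + 1) *
        Real.exp (-(k * Real.log 2 / ((ACForm.cB : ℝ) ^ (d + 1) * (ACForm.logM (2 * s) : ℝ) ^ (d - 1)))) := by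
  obtain ⟨f, hev, hh, hw, hsize⟩ := C.exists_acForm hC
  have hfun : (fun x => sgn (C.eval x)) = ACForm.sgnEval f := by
    funext x; rw [ACForm.sgnEval, hev]
  rw [hfun]
  have hM : 1 ≤ 2 * s := by omega
  have hdepth : f.height ≤ d + 1 := hh.trans (Nat.succ_le_succ ((acDepth_le_depth C).trans hd))
  have := ACForm.tailWeight_le_tailBound hM (d + 1) (by omega) f 1 le_rfl (ACForm.one_le_logM hM) hdepth
    (hsize.trans (by omega)) hw k
  unfold ACForm.tailBound at this
  simpa [show d + 1 - 2 = d - 1 by omega] using this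

/-! ### Digit identities: the constant coefficient from nonempty ones -/

/-- `μ(4r) = 0`. [folklore] -/
theorem moebius_eq_zero_of_four_dvd {r : ℕ} (h : 4 ∣ r) : ArithmeticFunction.moebius r = 0 := by
  apply ArithmeticFunction.moebius_eq_zero_of_not_squarefree
  intro hsq
  obtain ⟨k, rfl⟩ := h
  have h2 := hsq 2 ⟨k, by ring⟩
  rw [Nat.isUnit_iff] at h2
  exact absurd h2 (by norm_num)

/-- Two low zero digits: `x₀ = x₁ = 0 ⇒ 4 ∣ val x`. [folklore] -/
theorem four_dvd_val {m : ℕ} (x : Fin (m + 2) → Bool) (h0 : x 0 = false) (h1 : x 1 = false) :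
    4 ∣ bitsToNat (List.ofFn x) := by
  rw [List.ofFn_succ, List.ofFn_succ, bitsToNat_cons, bitsToNat_cons]
  simp only [Fin.succ_zero_eq_one, h0, h1, Bool.toNat_false, zero_add]
  exact ⟨bitsToNat (List.ofFn fun i : Fin m => x i.succ.succ), by ring⟩

/-- **Möbius, `S = ∅` from `S = {0}, {1}, {0,1}`**: `Σ_x μ(val x)(1 + χ₀(x))(1 + χ₁(x)) = 0`
termwise (a factor vanishes unless `x₀ = x₁ = 0`, and then `4 ∣ val x`, `μ(val x) = 0`), i.e.
`μ̂(∅) + μ̂({0}) + μ̂({1}) + μ̂({0,1}) = 0` (unnormalised). [folklore] -/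
theorem moebius_walshSum_empty_identity {m : ℕ} :
    walshSum (fun k => ArithmeticFunction.moebius k) (∅ : Finset (Fin (m + 2))) +
      walshSum (fun k => ArithmeticFunction.moebius k) ({0} : Finset (Fin (m + 2))) +
      walshSum (fun k => ArithmeticFunction.moebius k) ({1} : Finset (Fin (m + 2))) +
      walshSum (fun k => ArithmeticFunction.moebius k) ({0, 1} : Finset (Fin (m + 2))) = 0 := by
  simp only [walshSum_eq, ← Finset.sum_add_distrib]
  refine Finset.sum_eq_zero fun x _ => ?_
  have h01 : (0 : Fin (m + 2)) ≠ 1 := by simp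
  rw [Literature.Probability.RandomGraphs.LowDegree.walsh_empty, walsh, walsh, walsh,
    Finset.prod_singleton, Finset.prod_singleton, Finset.prod_pair h01]
  have key : (ArithmeticFunction.moebius (bitsToNat (List.ofFn x)) : ℝ) * ((1 + sgn (x 0)) * (1 + sgn (x 1))) = 0 := by
    rcases hx0 : x 0 with _ | _
    · rcases hx1 : x 1 with _ | _
      · have : (ArithmeticFunction.moebius (bitsToNat (List.ofFn x)) : ℝ) = 0 := by
          exact_mod_cast moebius_eq_zero_of_four_dvd (four_dvd_val x hx0 hx1)
        rw [this, zero_mul]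
      · simp [sgn]
    · simp [sgn]
  linear_combination key

/-- `λ(2k) = -λ(k)` (complete multiplicativity, `λ(2) = -1`; also at `k = 0`). [folklore] -/
theorem liouville_two_mul (k : ℕ) : ArithmeticFunction.liouville (2 * k) = -ArithmeticFunction.liouville k := by
  rw [ArithmeticFunction.liouville_apply_mul,
    ArithmeticFunction.liouville_apply two_ne_zero, ArithmeticFunction.cardFactors_apply_prime Nat.prime_two]
  ring

/-- `val (b :: y) = b + 2 val y`. [folklore] -/
theorem val_cons (b : Bool) (y : Fin n → Bool) :
    bitsToNat (List.ofFn (Fin.cons b y : Fin (n + 1) → Bool)) = b.toNat + 2 * bitsToNat (List.ofFn y) := by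
  rw [List.ofFn_cons, bitsToNat_cons]

/-- `val (y ++ [b]) = val y + 2ⁿ b`. [folklore] -/
theorem val_snoc (y : Fin n → Bool) (b : Bool) :
    bitsToNat (List.ofFn (Fin.snoc y b : Fin (n + 1) → Bool)) = bitsToNat (List.ofFn y) + 2 ^ n * b.toNat := by
  rw [List.ofFn_succ']
  simp only [Fin.snoc_castSucc, Fin.snoc_last, List.concat_eq_append, bitsToNat_append, List.length_ofFn,
    bitsToNat_cons, bitsToNat_nil, mul_zero, add_zero]

/-- Sums over `{0,1}ⁿ⁺¹` by the lowest digit. [folklore] -/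
theorem sum_cube_succ_cons (F : (Fin (n + 1) → Bool) → ℝ) :
    ∑ x, F x = ∑ y : Fin n → Bool, F (Fin.cons true y) + ∑ y : Fin n → Bool, F (Fin.cons false y) := by
  rw [← (Fin.consEquiv fun _ : Fin (n + 1) => Bool).sum_comp, Fintype.sum_prod_type, Fintype.sum_bool]
  rfl

/-- Sums over `{0,1}ⁿ⁺¹` by the top digit. [folklore] -/
theorem sum_cube_succ_snoc (F : (Fin (n + 1) → Bool) → ℝ) :
    ∑ x, F x = ∑ y : Fin n → Bool, F (Fin.snoc y true) + ∑ y : Fin n → Bool, F (Fin.snoc y false) := by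
  rw [← (Fin.snocEquiv fun _ : Fin (n + 1) => Bool).sum_comp, Fintype.sum_prod_type, Fintype.sum_bool]
  rfl

/-- **Liouville, lowest digit**: `λ̂ₙ₊₁(∅) + λ̂ₙ₊₁({0}) = -2 λ̂ₙ(∅)` (unnormalised sums), from
`λ(2k) = -λ(k)`. [folklore] -/
theorem liouville_walshSum_cons_identity (n : ℕ) :
    walshSum (fun k => ArithmeticFunction.liouville k) (∅ : Finset (Fin (n + 1))) +
      walshSum (fun k => ArithmeticFunction.liouville k) ({0} : Finset (Fin (n + 1))) =
      -2 * walshSum (fun k => ArithmeticFunction.liouville k) (∅ : Finset (Fin n)) := by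
  simp only [walshSum_eq, ← Finset.sum_add_distrib, walsh, Finset.prod_singleton]
  rw [sum_cube_succ_cons]
  simp only [Fin.cons_zero, sgn, if_true, Bool.false_eq_true, if_false, val_cons, Bool.toNat_true,
    Bool.toNat_false, zero_add, liouville_two_mul]
  rw [Finset.mul_sum, ← Finset.sum_add_distrib]
  refine Finset.sum_congr rfl fun y _ => ?_
  push_cast; ring

/-- **Liouville, top digit**: `λ̂ₙ₊₁(∅) + λ̂ₙ₊₁({n}) = 2 λ̂ₙ(∅)` (unnormalised sums). [folklore] -/
theorem liouville_walshSum_snoc_identity (n : ℕ) :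
    walshSum (fun k => ArithmeticFunction.liouville k) (∅ : Finset (Fin (n + 1))) +
      walshSum (fun k => ArithmeticFunction.liouville k) ({Fin.last n} : Finset (Fin (n + 1))) =
      2 * walshSum (fun k => ArithmeticFunction.liouville k) (∅ : Finset (Fin n)) := by
  simp only [walshSum_eq, ← Finset.sum_add_distrib, walsh, Finset.prod_singleton]
  rw [sum_cube_succ_snoc]
  simp only [Fin.snoc_last, sgn, if_true, Bool.false_eq_true, if_false, val_snoc, Bool.toNat_true,
    Bool.toNat_false, mul_zero, add_zero]
  rw [Finset.mul_sum, ← Finset.sum_add_distrib]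
  refine Finset.sum_congr rfl fun y _ => ?_
  ring

/-! ### Numerical bookkeeping -/

/-- **Low levels** (Green 2012, §2: `n^{n^{1/6}} sup_{|S| ≤ n^{1/6}} |μ̂(S)| = O(e^{-cn^{1/3}})`, here
in the form used below): with `k = ⌊v⌋`, `v = n^{1/6} ≥ 576/c²`, `c ≤ 1`, `L = ln n ≤ 12 √v`,
`(k+1) e^{kL} · K k e^{-c v³/k} ≤ K e^{-(c/2) v}`. [cite: Green2012, §2] -/
theorem low_numeric {c K v L : ℝ} (hc : 0 < c) (hc1 : c ≤ 1) (hK : 0 ≤ K) (hv : 576 / c ^ 2 ≤ v)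
    (hL0 : 0 ≤ L) (hL : L ≤ 12 * Real.sqrt v) :
    ((⌊v⌋₊ : ℝ) + 1) * Real.exp (⌊v⌋₊ * L) * (K * ⌊v⌋₊ * Real.exp (-(c * v ^ 3 / ⌊v⌋₊))) ≤
      K * Real.exp (-(c / 2 * v)) := by
  set k : ℕ := ⌊v⌋₊ with hk
  have hc2 : c ^ 2 ≤ 1 := by nlinarith
  have hv576 : (576 : ℝ) ≤ v := by
    refine le_trans ?_ hv
    rw [le_div_iff₀ (by positivity)]
    nlinarith
  have hv1 : (1 : ℝ) ≤ v := by linarith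
  have hv0 : 0 < v := by linarith
  have hk1 : 1 ≤ k := Nat.floor_pos.2 hv1
  have hkv : (k : ℝ) ≤ v := Nat.floor_le hv0.le
  have hk0 : (0 : ℝ) < k := by exact_mod_cast hk1
  set w := Real.sqrt v with hw
  have hw0 : 0 ≤ w := Real.sqrt_nonneg v
  have hwv : w ^ 2 = v := Real.sq_sqrt hv0.le
  have hw24 : 24 / c ≤ w := by
    have h1 : (24 / c : ℝ) = Real.sqrt ((24 / c) ^ 2) := by rw [Real.sqrt_sq (by positivity)]
    rw [h1, hw]
    refine Real.sqrt_le_sqrt ?_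
    calc (24 / c) ^ 2 = 576 / c ^ 2 := by rw [div_pow]; norm_num
      _ ≤ v := hv
  have hcw : 24 ≤ c * w := by
    have := mul_le_mul_of_nonneg_left hw24 hc.le
    rwa [mul_div_cancel₀ _ hc.ne'] at this
  have hw24' : 24 ≤ w := by
    refine le_trans ?_ hw24
    rw [le_div_iff₀ hc]; nlinarith
  have h1 : ((k : ℝ) + 1) * k ≤ Real.exp (2 * v) := by
    have e1 : (k : ℝ) + 1 ≤ Real.exp v := by linarith [Real.add_one_le_exp v]
    have e2 : (k : ℝ) ≤ Real.exp v := by linarith [Real.add_one_le_exp v]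
    calc ((k : ℝ) + 1) * k ≤ Real.exp v * Real.exp v := mul_le_mul e1 e2 hk0.le (Real.exp_pos v).le
      _ = Real.exp (2 * v) := by rw [← Real.exp_add]; ring_nf
  have h2 : Real.exp (k * L) ≤ Real.exp (12 * v * w) := by
    rw [Real.exp_le_exp]
    calc (k : ℝ) * L ≤ v * (12 * w) := mul_le_mul hkv hL hL0 hv0.le
      _ = 12 * v * w := by ring
  have h3 : Real.exp (-(c * v ^ 3 / k)) ≤ Real.exp (-(c * v ^ 2)) := by
    rw [Real.exp_le_exp, neg_le_neg_iff, le_div_iff₀ hk0]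
    calc c * v ^ 2 * k ≤ c * v ^ 2 * v := by gcongr
      _ = c * v ^ 3 := by ring
  have hexp : ((k : ℝ) + 1) * Real.exp (k * L) * (K * k * Real.exp (-(c * v ^ 3 / k))) =
      K * ((((k : ℝ) + 1) * k) * (Real.exp (k * L) * Real.exp (-(c * v ^ 3 / k)))) := by ring
  rw [hexp]
  refine mul_le_mul_of_nonneg_left ?_ hK
  calc (((k : ℝ) + 1) * k) * (Real.exp (k * L) * Real.exp (-(c * v ^ 3 / k)))
      ≤ Real.exp (2 * v) * (Real.exp (12 * v * w) * Real.exp (-(c * v ^ 2))) :=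
        mul_le_mul h1 (mul_le_mul h2 h3 (Real.exp_pos _).le (Real.exp_pos _).le) (by positivity) (Real.exp_pos _).le
    _ = Real.exp (2 * v + 12 * v * w - c * v ^ 2) := by rw [← Real.exp_add, ← Real.exp_add]; ring_nf
    _ ≤ Real.exp (-(c / 2 * v)) := by
        rw [Real.exp_le_exp]
        have key : 2 + 12 * w + c / 2 ≤ c * v := by
          rw [← hwv]; nlinarith [mul_nonneg hw0 (sub_nonneg.2 hcw), hw24', hc1]
        nlinarith [mul_nonneg hv0.le (sub_nonneg.2 key)]

/-- **High levels** (Green 2012, §2, last display, with Tal's bound): in the regime `c' u > d L / 2`,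
`u = n^{1/(6d)} > e`, from `R² ≤ 8^{d+1} exp(-k₁ ln 2/(B^{d+1} ℓ^{d-1}))`, `k₁ ≥ u^d = n^{1/6}`,
`1 ≤ ℓ ≤ 5 d L` and `c' ≤ 1/(6B²)` one gets `R ≤ e^{1 + dL - c'u}`. (Key steps: `d < c'u/3`,
`ℓ < 10 c' u`, hence `B^{d+1} ℓ^{d-1} ≤ B² u^{d-1}` and the exponent is `≥ u ln 2 / B²`.)
[cite: Green2012, §2] -/
theorem tail_numeric {d : ℕ} (hd : 1 ≤ d) {c' L u ℓ k₁ R : ℝ} (hc'0 : 0 < c')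
    (hc' : c' ≤ 1 / (6 * (ACForm.cB : ℝ) ^ 2))
    (hu : u = Real.exp (L / (6 * d))) (hue : Real.exp 1 < u) (hcase : d * L / 2 < c' * u)
    (hℓ1 : 1 ≤ ℓ) (hℓ : ℓ ≤ 5 * (d * L)) (hk : u ^ d ≤ k₁) (hR0 : 0 ≤ R)
    (hR : R ^ 2 ≤ (ACForm.cA : ℝ) ^ (d + 1) *
      Real.exp (-(k₁ * Real.log 2 / ((ACForm.cB : ℝ) ^ (d + 1) * ℓ ^ (d - 1))))) :
    R ≤ Real.exp (1 + d * L - c' * u) := by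
  have hcB : (ACForm.cB : ℝ) = 16896 := by unfold ACForm.cB ACForm.B0; norm_num
  have hcA : (ACForm.cA : ℝ) = 8 := by unfold ACForm.cA; norm_num
  have hd1 : (1 : ℝ) ≤ d := by exact_mod_cast hd
  have hd0 : (0 : ℝ) < d := by linarith
  set lu := L / (6 * d) with hlu
  have hlu1 : 1 < lu := by rwa [hu, Real.exp_lt_exp] at hue
  have hL : L = 6 * d * lu := by rw [hlu]; field_simp
  have hu0 : 0 < u := by rw [hu]; exact Real.exp_pos _
  have hl2 := Real.log_two_gt_d9
  have hl2' := Real.log_two_lt_d9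
  -- `d < c' u / 3`, `d L < 2 c' u`
  have hd3 : 3 * (d : ℝ) < c' * u := by
    have h1 : 3 * (d : ℝ) ≤ 3 * d ^ 2 * lu := by nlinarith
    have h2 : 3 * (d : ℝ) ^ 2 * lu = d * L / 2 := by rw [hL]; ring
    linarith
  have hdL : (d : ℝ) * L < 2 * (c' * u) := by linarith
  have hL0 : 0 ≤ (d : ℝ) * L := by rw [hL]; positivity
  -- the denominator
  have hB0 : (0 : ℝ) < ACForm.cB := by rw [hcB]; norm_num
  have hℓ0 : 0 < ℓ := by linarith
  have hℓu : ℓ ≤ 10 * c' * u := by linarith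
  have h10 : 10 * c' * (ACForm.cB : ℝ) ≤ 1 := by
    rw [hcB] at *
    have : c' ≤ 1 / (6 * (16896 : ℝ) ^ 2) := hc'
    have h' : c' * (6 * (16896 : ℝ) ^ 2) ≤ 1 := by rwa [le_div_iff₀ (by norm_num)] at this
    nlinarith
  have hD0 : 0 < (ACForm.cB : ℝ) ^ (d + 1) * ℓ ^ (d - 1) := by positivity
  have hD : (ACForm.cB : ℝ) ^ (d + 1) * ℓ ^ (d - 1) ≤ (ACForm.cB : ℝ) ^ 2 * u ^ (d - 1) := by
    calc (ACForm.cB : ℝ) ^ (d + 1) * ℓ ^ (d - 1) ≤ (ACForm.cB : ℝ) ^ (d + 1) * (10 * c' * u) ^ (d - 1) := by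
          gcongr
      _ = (ACForm.cB : ℝ) ^ 2 * ((10 * c' * ACForm.cB) ^ (d - 1) * u ^ (d - 1)) := by
          rw [show d + 1 = 2 + (d - 1) by omega, pow_add, mul_assoc, ← mul_pow, ← mul_pow,
            show (ACForm.cB : ℝ) * (10 * c' * u) = 10 * c' * ACForm.cB * u by ring]
      _ ≤ (ACForm.cB : ℝ) ^ 2 * (1 * u ^ (d - 1)) := by
          gcongr
          exact pow_le_one₀ (by positivity) h10
      _ = (ACForm.cB : ℝ) ^ 2 * u ^ (d - 1) := by rw [one_mul]
  -- the exponent `E ≥ u log 2 / B²`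
  set E := k₁ * Real.log 2 / ((ACForm.cB : ℝ) ^ (d + 1) * ℓ ^ (d - 1)) with hE
  have hE1 : u * Real.log 2 / (ACForm.cB : ℝ) ^ 2 ≤ E := by
    have e1 : u * Real.log 2 / (ACForm.cB : ℝ) ^ 2 = u ^ d * Real.log 2 / ((ACForm.cB : ℝ) ^ 2 * u ^ (d - 1)) := by
      have : u ^ d = u ^ (d - 1) * u := by rw [← pow_succ, Nat.sub_add_cancel hd]
      rw [this]; field_simp
    rw [e1]
    calc u ^ d * Real.log 2 / ((ACForm.cB : ℝ) ^ 2 * u ^ (d - 1))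
        ≤ u ^ d * Real.log 2 / ((ACForm.cB : ℝ) ^ (d + 1) * ℓ ^ (d - 1)) :=
          div_le_div_of_nonneg_left (by positivity) hD0 hD
      _ ≤ E := by rw [hE]; exact div_le_div_of_nonneg_right (by nlinarith) hD0.le
  -- compare exponents
  have hsq : R ^ 2 ≤ Real.exp (1 + d * L - c' * u) ^ 2 := by
    refine hR.trans ?_
    rw [← Real.exp_nat_mul, hcA, show (8 : ℝ) ^ (d + 1) = Real.exp ((d + 1 : ℕ) * Real.log 8) by
      rw [Real.exp_nat_mul, Real.exp_log (by norm_num)], ← Real.exp_add, Real.exp_le_exp]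
    have hlog8 : Real.log 8 = 3 * Real.log 2 := by
      rw [show (8 : ℝ) = 2 ^ 3 by norm_num, Real.log_pow]; norm_num
    rw [hlog8]
    push_cast
    set q := u / (ACForm.cB : ℝ) ^ 2 with hq
    have hq0 : 0 < q := by positivity
    have hcu : c' * u ≤ q / 6 := by
      rw [hq, hcB] at *
      have : c' * u ≤ 1 / (6 * (16896 : ℝ) ^ 2) * u := mul_le_mul_of_nonneg_right hc' hu0.le
      have e : 1 / (6 * (16896 : ℝ) ^ 2) * u = u / 16896 ^ 2 / 6 := by ring
      linarith
    have hEq : q * Real.log 2 ≤ E := by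
      have : q * Real.log 2 = u * Real.log 2 / (ACForm.cB : ℝ) ^ 2 := by rw [hq]; ring
      linarith
    nlinarith
  exact (pow_le_pow_iff_left₀ hR0 (Real.exp_pos _).le two_ne_zero).1 hsq

/-! ### The main estimate -/

/-- Uniform bound on the coefficients of the levels `≤ k₀` (`k₀ ≥ 1`) from the two Walsh bounds:
`|ĝ(S)| ≤ K k₀ e^{-c√n/k₀}`. [cite: Green2012, §2] -/
theorem coeff_le_of_walsh_bounds (g : ℕ → ℤ) {c K : ℝ} (hc : 0 ≤ c) (hK : 0 ≤ K)
    (hX : ∀ S : Finset (Fin n), S.Nonempty →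
      |walshSum g S| / 2 ^ n ≤ K * S.card * Real.exp (-(c * Real.sqrt n / S.card)))
    (h0 : |walshSum g (∅ : Finset (Fin n))| / 2 ^ n ≤ K * Real.exp (-(c * Real.sqrt n)))
    {k₀ : ℕ} (hk₀ : 1 ≤ k₀) (S : Finset (Fin n)) (hS : S.card ≤ k₀) :
    |cubeFourierCoeff (fun x : Fin n → Bool => (g (bitsToNat (List.ofFn x)) : ℝ)) S| ≤
      K * k₀ * Real.exp (-(c * Real.sqrt n / k₀)) := by
  rw [← walshSum_div_eq, abs_div, abs_of_pos (by positivity : (0 : ℝ) < 2 ^ n)]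
  have hk1 : (1 : ℝ) ≤ k₀ := by exact_mod_cast hk₀
  rcases S.eq_empty_or_nonempty with rfl | hne
  · refine h0.trans ?_
    have e1 : K ≤ K * k₀ := le_mul_of_one_le_right hK hk1
    have e2 : Real.exp (-(c * Real.sqrt n)) ≤ Real.exp (-(c * Real.sqrt n / k₀)) := by
      rw [Real.exp_le_exp, neg_le_neg_iff]
      exact div_le_self (by positivity) hk1
    exact mul_le_mul e1 e2 (Real.exp_pos _).le (by positivity)
  · refine (hX S hne).trans ?_
    have hc1 : (1 : ℝ) ≤ S.card := by exact_mod_cast Finset.card_pos.2 hne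
    have hcs : (S.card : ℝ) ≤ k₀ := by exact_mod_cast hS
    have e2 : Real.exp (-(c * Real.sqrt n / S.card)) ≤ Real.exp (-(c * Real.sqrt n / k₀)) := by
      rw [Real.exp_le_exp, neg_le_neg_iff]
      exact div_le_div_of_nonneg_left (by positivity) (by linarith) hcs
    exact mul_le_mul (mul_le_mul_of_nonneg_left hcs hK) e2 (Real.exp_pos _).le (by positivity)

/-- **Green 2012, §2, for a general bounded arithmetic function** `g : ℕ → ℤ`, `|g| ≤ 1`: Walsh
bounds of the shape of Proposition 1 (`|ĝₙ(S)| ≤ K |S| e^{-c√n/|S|}`, `S ≠ ∅`, `n ≥ 1`) and a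
bound `|ĝₙ(∅)| ≤ K e^{-c√n}` (`n ≥ 2`) imply the bound of Theorem 1: for `d, n ≥ 1` and every
circuit over `acBasis` of depth `≤ d` (all gates counted) and size `≤ nᵈ`,
`|corr(g, C)|/2ⁿ ≤ K' exp(d log n - c' n^{1/(6d)})` with `c' = min(c/2, 1/(6·16896²))`,
`K' = e^{576 c'/c²} + 2K + 3`. Proof: trivial bound for `n^{1/6} < 576/c²`; otherwise Parseval,
`abs_sum_coeff_mul_le` with `k₀ = ⌊n^{1/6}⌋`, `low_numeric`, and for the high part `R ≤ 1` or
Tal's tail bound with `tail_numeric`. [cite: Green2012, §2] -/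
theorem acd_of_walsh_bounds (g : ℕ → ℤ) (hg : ∀ m, |g m| ≤ 1) {c K : ℝ} (hc : 0 < c) (hc1 : c ≤ 1)
    (hK : 1 ≤ K)
    (hX : ∀ n : ℕ, 1 ≤ n → ∀ S : Finset (Fin n), S.Nonempty →
      |walshSum g S| / 2 ^ n ≤ K * S.card * Real.exp (-(c * Real.sqrt n / S.card)))
    (h0 : ∀ n : ℕ, 2 ≤ n → |walshSum g (∅ : Finset (Fin n))| / 2 ^ n ≤ K * Real.exp (-(c * Real.sqrt n))) :
    ∃ c' : ℝ, 0 < c' ∧ ∃ K' : ℝ, ∀ (d n : ℕ), 1 ≤ d → 1 ≤ n →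
      ∀ C : Circuit (Fin n), C.IsOver acBasis → C.depth ≤ d → C.size ≤ n ^ d →
        |circuitCorrelation g C| / 2 ^ n ≤
          K' * Real.exp (d * Real.log n - c' * (n : ℝ) ^ (1 / (6 * (d : ℝ)))) := by
  have hcB : (ACForm.cB : ℝ) = 16896 := by unfold ACForm.cB ACForm.B0; norm_num
  set c' : ℝ := min (c / 2) (1 / (6 * (ACForm.cB : ℝ) ^ 2)) with hc'def
  have hc'0 : 0 < c' := lt_min (by linarith) (by rw [hcB]; norm_num)
  have hc'c : c' ≤ c / 2 := min_le_left _ _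
  have hc'B : c' ≤ 1 / (6 * (ACForm.cB : ℝ) ^ 2) := min_le_right _ _
  have hc'3 : c' ≤ 1 / 3 := hc'B.trans (by rw [hcB]; norm_num)
  set v₀ : ℝ := 576 / c ^ 2 with hv₀
  refine ⟨c', hc'0, Real.exp (c' * v₀) + (2 * K + 3), ?_⟩
  intro d n hd hn C hC hdepth hsize
  have hK0 : 0 ≤ K := by linarith
  have hnpos : (0 : ℝ) < n := by exact_mod_cast hn
  have hd0 : (0 : ℝ) < d := by exact_mod_cast hd
  have hd1 : (1 : ℝ) ≤ d := by exact_mod_cast hd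
  have hL0 : 0 ≤ Real.log n := Real.log_nonneg (by exact_mod_cast hn)
  set u := Real.exp (Real.log n / (6 * d)) with hudef
  set v := Real.exp (Real.log n / 6) with hvdef
  have hu_rpow : (n : ℝ) ^ (1 / (6 * (d : ℝ))) = u := by
    rw [Real.rpow_def_of_pos hnpos, hudef]; congr 1; ring
  rw [hu_rpow]
  have hu0 : 0 < u := Real.exp_pos _
  have hv0 : 0 < v := Real.exp_pos _
  have huv : u ≤ v := by
    rw [hudef, hvdef, Real.exp_le_exp, div_le_div_iff₀ (by positivity) (by norm_num)]
    nlinarith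
  have hdL0 : 0 ≤ (d : ℝ) * Real.log n := mul_nonneg hd0.le hL0
  by_cases hsmall : v < v₀
  · -- trivial regime: the claimed bound is at least `1`
    refine (abs_circuitCorrelation_div_le_one g hg C).trans ?_
    have h1 : (1 : ℝ) ≤ Real.exp (c' * v₀) * Real.exp (d * Real.log n - c' * u) := by
      rw [← Real.exp_add]
      apply Real.one_le_exp
      have : c' * u ≤ c' * v₀ := by nlinarith [hsmall.le]
      linarith
    calc (1 : ℝ) ≤ Real.exp (c' * v₀) * Real.exp (d * Real.log n - c' * u) := h1
      _ ≤ (Real.exp (c' * v₀) + (2 * K + 3)) * Real.exp (d * Real.log n - c' * u) := by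
          gcongr; linarith
  · push Not at hsmall
    -- main regime `v ≥ 576 / c²`; in particular `n ≥ 2`
    have hc2 : c ^ 2 ≤ 1 := by nlinarith
    have hv576 : (576 : ℝ) ≤ v := by
      refine le_trans ?_ hsmall
      rw [hv₀, le_div_iff₀ (by positivity)]; nlinarith
    have hv1 : (1 : ℝ) ≤ v := by linarith
    have hlogv : Real.log v = Real.log n / 6 := by rw [hvdef, Real.log_exp]
    have hlog2 : Real.log 2 ≤ Real.log n := by
      have h1 : Real.log 2 ≤ Real.log 576 := Real.log_le_log (by norm_num) (by norm_num)
      have h2 : Real.log 576 ≤ Real.log v := Real.log_le_log (by norm_num) hv576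
      have h3 : 0 ≤ Real.log 2 := Real.log_nonneg (by norm_num)
      linarith
    have hn2r : (2 : ℝ) ≤ n := (Real.log_le_log_iff (by norm_num) hnpos).1 hlog2
    have hn2 : 2 ≤ n := by exact_mod_cast hn2r
    -- `k₀ = ⌊v⌋ = ⌊n^{1/6}⌋`
    set k₀ : ℕ := ⌊v⌋₊ with hk₀def
    have hk₀1 : 1 ≤ k₀ := Nat.floor_pos.2 hv1
    have hvk₀ : v < k₀ + 1 := Nat.lt_floor_add_one v
    have hB : ∀ S : Finset (Fin n), S.card ≤ k₀ →
        |cubeFourierCoeff (fun x : Fin n → Bool => (g (bitsToNat (List.ofFn x)) : ℝ)) S| ≤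
          K * k₀ * Real.exp (-(c * Real.sqrt n / k₀)) :=
      coeff_le_of_walsh_bounds g hc.le hK0 (hX n hn) (h0 n hn2) hk₀1
    -- the two functions on the cube
    have hF1 : ∀ x : Fin n → Bool, |sgn (C.eval x)| ≤ 1 := fun x => by
      unfold sgn; split_ifs <;> simp
    have hF2 : ∀ x : Fin n → Bool, sgn (C.eval x) ^ 2 = 1 := fun x => by
      unfold sgn; split_ifs <;> norm_num
    have hG2 : ∀ x : Fin n → Bool, ((g (bitsToNat (List.ofFn x)) : ℝ)) ^ 2 ≤ 1 := fun x => by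
      have h : |((g (bitsToNat (List.ofFn x)) : ℝ))| ≤ 1 := by exact_mod_cast hg _
      exact (sq_le_one_iff_abs_le_one _).2 h
    rw [abs_circuitCorrelation_div_eq]
    have hsplit := abs_sum_coeff_mul_le (fun x : Fin n → Bool => (g (bitsToNat (List.ofFn x)) : ℝ))
      (fun x => sgn (C.eval x)) k₀ hF1 hB
    -- low part
    have hsqrt : Real.sqrt n = v ^ 3 := by
      rw [Real.sqrt_eq_rpow, Real.rpow_def_of_pos hnpos, hvdef, ← Real.exp_nat_mul]; congr 1; ring
    have hnk : (n : ℝ) ^ k₀ = Real.exp (k₀ * Real.log n) := by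
      rw [← Real.rpow_natCast, Real.rpow_def_of_pos hnpos, mul_comm]
    have hLv : Real.log n ≤ 12 * Real.sqrt v := by
      have h := Real.log_le_rpow_div hv0.le (by norm_num : (0 : ℝ) < 1 / 2)
      rw [hlogv, ← Real.sqrt_eq_rpow] at h
      have : Real.sqrt v / (1 / 2) = 2 * Real.sqrt v := by ring
      linarith
    have hlow : ((univ.filter (fun S : Finset (Fin n) => S.card ≤ k₀)).card : ℝ) *
          (K * k₀ * Real.exp (-(c * Real.sqrt n / k₀))) ≤ K * Real.exp (d * Real.log n - c' * u) := by
      calc ((univ.filter (fun S : Finset (Fin n) => S.card ≤ k₀)).card : ℝ) *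
            (K * k₀ * Real.exp (-(c * Real.sqrt n / k₀)))
          ≤ ((k₀ : ℝ) + 1) * (n : ℝ) ^ k₀ * (K * k₀ * Real.exp (-(c * Real.sqrt n / k₀))) :=
            mul_le_mul_of_nonneg_right (card_filter_card_le hn k₀) (by positivity)
        _ = ((⌊v⌋₊ : ℝ) + 1) * Real.exp (⌊v⌋₊ * Real.log n) *
              (K * ⌊v⌋₊ * Real.exp (-(c * v ^ 3 / ⌊v⌋₊))) := by rw [hnk, hsqrt]
        _ ≤ K * Real.exp (-(c / 2 * v)) := low_numeric hc hc1 hK0 hsmall hL0 hLv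
        _ ≤ K * Real.exp (d * Real.log n - c' * u) := by
            refine mul_le_mul_of_nonneg_left (Real.exp_le_exp.2 ?_) hK0
            nlinarith [mul_le_mul_of_nonneg_left huv hc'0.le]
    -- high part
    have hR0 := hiPart_nonneg (fun x : Fin n → Bool => (g (bitsToNat (List.ofFn x)) : ℝ)) (fun x => sgn (C.eval x))
      (k₀ + 1)
    have hhigh : ∑ S ∈ univ.filter (fun S : Finset (Fin n) => k₀ + 1 ≤ S.card),
        |cubeFourierCoeff (fun x : Fin n → Bool => (g (bitsToNat (List.ofFn x)) : ℝ)) S| *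
          |cubeFourierCoeff (fun x => sgn (C.eval x)) S| ≤
        Real.exp 1 * Real.exp (d * Real.log n - c' * u) := by
      rw [← Real.exp_add]
      by_cases hcase : c' * u ≤ d * Real.log n / 2 ∨ u ≤ Real.exp 1
      · refine (hiPart_le_one _ _ hG2 hF2 _).trans (Real.one_le_exp ?_)
        rcases hcase with h | h
        · linarith
        · have : c' * u ≤ 1 := by
            calc c' * u ≤ (1 / 3) * Real.exp 1 := mul_le_mul hc'3 h hu0.le (by norm_num)
              _ ≤ 1 := by have := Real.exp_one_lt_three; linarith
          linarith
      · push Not at hcase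
        obtain ⟨hcase1, hcase2⟩ := hcase
        have hs1 : 1 ≤ n ^ d := Nat.one_le_pow _ _ (by omega)
        have htail := tailWeight_circuit_le C hC hd hdepth hsize hs1 (k₀ + 1)
        have hR2 := (hiPart_sq_le (fun x : Fin n → Bool => (g (bitsToNat (List.ofFn x)) : ℝ))
          (fun x => sgn (C.eval x)) hG2 (k₀ + 1)).trans htail
        have hℓ1 : (1 : ℝ) ≤ (ACForm.logM (2 * n ^ d) : ℝ) := by
          exact_mod_cast ACForm.one_le_logM (show 1 ≤ 2 * n ^ d by omega)
        have hℓ : (ACForm.logM (2 * n ^ d) : ℝ) ≤ 5 * (d * Real.log n) := by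
          have h := ACForm.logM_two_mul_le (s := n ^ d) (hn2.trans (Nat.le_self_pow (by omega) n))
          rwa [Nat.cast_pow, Real.log_pow] at h
        have hud : u ^ d ≤ ((k₀ + 1 : ℕ) : ℝ) := by
          have : u ^ d = v := by
            rw [hudef, hvdef, ← Real.exp_nat_mul]; congr 1; field_simp
          rw [this]; push_cast; exact hvk₀.le
        have := tail_numeric hd hc'0 hc'B hudef hcase2 hcase1 hℓ1 hℓ hud hR0 hR2
        refine this.trans (le_of_eq ?_)
        congr 1; ring
    -- assemble
    calc |∑ S, cubeFourierCoeff (fun x : Fin n → Bool => (g (bitsToNat (List.ofFn x)) : ℝ)) S *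
          cubeFourierCoeff (fun x => sgn (C.eval x)) S|
        ≤ _ := hsplit
      _ ≤ K * Real.exp (d * Real.log n - c' * u) + Real.exp 1 * Real.exp (d * Real.log n - c' * u) :=
          add_le_add hlow hhigh
      _ = (K + Real.exp 1) * Real.exp (d * Real.log n - c' * u) := by ring
      _ ≤ (Real.exp (c' * v₀) + (2 * K + 3)) * Real.exp (d * Real.log n - c' * u) := by
          refine mul_le_mul_of_nonneg_right ?_ (Real.exp_pos _).le
          have := Real.exp_one_lt_three
          have := (Real.exp_pos (c' * v₀)).le
          linarith

/-! ### Specialisation to `μ` and `λ` -/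

/-- Weakening the constants of a Walsh bound: smaller `c`, larger nonnegative `K`. [folklore] -/
theorem walsh_bound_mono {g : ℕ → ℤ} {c c₂ K K₂ : ℝ} (hcc : c₂ ≤ c) (hK₂ : 0 ≤ K₂) (hKK : K ≤ K₂)
    (hX : ∀ n : ℕ, 1 ≤ n → ∀ S : Finset (Fin n), S.Nonempty →
      |walshSum g S| / 2 ^ n ≤ K * S.card * Real.exp (-(c * Real.sqrt n / S.card))) :
    ∀ n : ℕ, 1 ≤ n → ∀ S : Finset (Fin n), S.Nonempty →
      |walshSum g S| / 2 ^ n ≤ K₂ * S.card * Real.exp (-(c₂ * Real.sqrt n / S.card)) := by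
  intro n hn S hS
  refine (hX n hn S hS).trans ?_
  have hcard : (0 : ℝ) < S.card := by exact_mod_cast Finset.card_pos.2 hS
  have e : Real.exp (-(c * Real.sqrt n / S.card)) ≤ Real.exp (-(c₂ * Real.sqrt n / S.card)) := by
    rw [Real.exp_le_exp, neg_le_neg_iff]
    exact div_le_div_of_nonneg_right (mul_le_mul_of_nonneg_right hcc (Real.sqrt_nonneg _)) hcard.le
  exact mul_le_mul (mul_le_mul_of_nonneg_right hKK hcard.le) e (Real.exp_pos _).le (by positivity)

/-- A Walsh bound at a set of size `≤ 2`, unnormalised: `|Σ_x g(val x)χ_S(x)| ≤ 2ⁿ · 2K e^{-(c/2)√n}`. [folklore] -/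
theorem walsh_bound_card_le_two {g : ℕ → ℤ} {c K : ℝ} (hc : 0 ≤ c) (hK : 0 ≤ K)
    (hX : ∀ n : ℕ, 1 ≤ n → ∀ S : Finset (Fin n), S.Nonempty →
      |walshSum g S| / 2 ^ n ≤ K * S.card * Real.exp (-(c * Real.sqrt n / S.card)))
    {n : ℕ} (hn : 1 ≤ n) (S : Finset (Fin n)) (hS : S.Nonempty) (h2 : S.card ≤ 2) :
    |walshSum g S| ≤ 2 ^ n * (2 * K * Real.exp (-(c / 2 * Real.sqrt n))) := by
  have h := hX n hn S hS
  rw [div_le_iff₀ (by positivity)] at h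
  refine h.trans ?_
  rw [mul_comm _ ((2 : ℝ) ^ n)]
  refine mul_le_mul_of_nonneg_left ?_ (by positivity)
  have hcard1 : (1 : ℝ) ≤ S.card := by exact_mod_cast Finset.card_pos.2 hS
  have hcard2 : (S.card : ℝ) ≤ 2 := by exact_mod_cast h2
  have e : Real.exp (-(c * Real.sqrt n / S.card)) ≤ Real.exp (-(c / 2 * Real.sqrt n)) := by
    rw [Real.exp_le_exp, neg_le_neg_iff, le_div_iff₀ (by linarith)]
    have := Real.sqrt_nonneg (n : ℝ)
    nlinarith [mul_nonneg hc this]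
  calc K * S.card * Real.exp (-(c * Real.sqrt n / S.card)) ≤ K * 2 * Real.exp (-(c / 2 * Real.sqrt n)) :=
        mul_le_mul (mul_le_mul_of_nonneg_left hcard2 hK) e (Real.exp_pos _).le (by positivity)
    _ = 2 * K * Real.exp (-(c / 2 * Real.sqrt n)) := by ring

/-- **Möbius, the constant coefficient from Proposition 1 alone**: for `n ≥ 2`,
`|μ̂ₙ(∅)| ≤ 6K e^{-(c/2)√n}`, by `moebius_walshSum_empty_identity` and the Walsh bounds at
`{0}, {1}, {0,1}` (no prime number theorem is used). [folklore] -/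
theorem moebius_walshSum_empty_le {c K : ℝ} (hc : 0 ≤ c) (hK : 0 ≤ K)
    (hX : ∀ n : ℕ, 1 ≤ n → ∀ S : Finset (Fin n), S.Nonempty →
      |walshSum (fun k => ArithmeticFunction.moebius k) S| / 2 ^ n ≤
        K * S.card * Real.exp (-(c * Real.sqrt n / S.card)))
    {n : ℕ} (hn : 2 ≤ n) :
    |walshSum (fun k => ArithmeticFunction.moebius k) (∅ : Finset (Fin n))| / 2 ^ n ≤
      6 * K * Real.exp (-(c / 2 * Real.sqrt n)) := by
  obtain ⟨m, rfl⟩ : ∃ m, n = m + 2 := ⟨n - 2, by omega⟩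
  have hn1 : 1 ≤ m + 2 := by omega
  have hid := moebius_walshSum_empty_identity (m := m)
  have h0 := walsh_bound_card_le_two hc hK hX hn1 ({0} : Finset (Fin (m + 2))) (by simp) (by simp)
  have h1 := walsh_bound_card_le_two hc hK hX hn1 ({1} : Finset (Fin (m + 2))) (by simp) (by simp)
  have h01 := walsh_bound_card_le_two hc hK hX hn1 ({0, 1} : Finset (Fin (m + 2))) (by simp)
    (Finset.card_insert_le _ _)
  rw [div_le_iff₀ (by positivity)]
  have e : walshSum (fun k => ArithmeticFunction.moebius k) (∅ : Finset (Fin (m + 2))) =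
      -(walshSum (fun k => ArithmeticFunction.moebius k) ({0} : Finset (Fin (m + 2))) +
        walshSum (fun k => ArithmeticFunction.moebius k) ({1} : Finset (Fin (m + 2))) +
        walshSum (fun k => ArithmeticFunction.moebius k) ({0, 1} : Finset (Fin (m + 2)))) := by
    linear_combination hid
  rw [e, abs_neg]
  refine (abs_add_three _ _ _).trans ?_
  have := add_le_add (add_le_add h0 h1) h01
  refine this.trans (le_of_eq ?_)
  push_cast; ring

/-- **Liouville, the constant coefficient from Proposition 1 alone**: for every `n`,
`|λ̂ₙ(∅)| ≤ 2K e^{-(c/2)√n}`, since `4·Σ_{x<2ⁿ} λ = W_{{n}} - W_{{0}}` at level `n + 1` by the two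
digit identities (no prime number theorem is used). [folklore] -/
theorem liouville_walshSum_empty_le {c K : ℝ} (hc : 0 ≤ c) (hK : 0 ≤ K)
    (hX : ∀ n : ℕ, 1 ≤ n → ∀ S : Finset (Fin n), S.Nonempty →
      |walshSum (fun k => ArithmeticFunction.liouville k) S| / 2 ^ n ≤
        K * S.card * Real.exp (-(c * Real.sqrt n / S.card)))
    (n : ℕ) :
    |walshSum (fun k => ArithmeticFunction.liouville k) (∅ : Finset (Fin n))| / 2 ^ n ≤
      2 * K * Real.exp (-(c / 2 * Real.sqrt n)) := by
  have hn1 : 1 ≤ n + 1 := by omega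
  have h0 := walsh_bound_card_le_two hc hK hX hn1 ({0} : Finset (Fin (n + 1))) (by simp) (by simp)
  have hl := walsh_bound_card_le_two hc hK hX hn1 ({Fin.last n} : Finset (Fin (n + 1))) (by simp) (by simp)
  have e : 4 * walshSum (fun k => ArithmeticFunction.liouville k) (∅ : Finset (Fin n)) =
      walshSum (fun k => ArithmeticFunction.liouville k) ({Fin.last n} : Finset (Fin (n + 1))) -
        walshSum (fun k => ArithmeticFunction.liouville k) ({0} : Finset (Fin (n + 1))) := by
    linear_combination liouville_walshSum_cons_identity n - liouville_walshSum_snoc_identity n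
  have hsq : Real.exp (-(c / 2 * Real.sqrt (((n + 1 : ℕ) : ℝ)))) ≤ Real.exp (-(c / 2 * Real.sqrt n)) := by
    rw [Real.exp_le_exp, neg_le_neg_iff]
    refine mul_le_mul_of_nonneg_left (Real.sqrt_le_sqrt ?_) (by positivity)
    push_cast; linarith
  rw [div_le_iff₀ (by positivity)]
  have h4 : 4 * |walshSum (fun k => ArithmeticFunction.liouville k) (∅ : Finset (Fin n))| ≤
      2 ^ (n + 1) * (2 * K * Real.exp (-(c / 2 * Real.sqrt (((n + 1 : ℕ) : ℝ))))) +
        2 ^ (n + 1) * (2 * K * Real.exp (-(c / 2 * Real.sqrt (((n + 1 : ℕ) : ℝ))))) := by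
    rw [show (4 : ℝ) * |walshSum (fun k => ArithmeticFunction.liouville k) (∅ : Finset (Fin n))| =
      |4 * walshSum (fun k => ArithmeticFunction.liouville k) (∅ : Finset (Fin n))| by
        rw [abs_mul]; norm_num, e]
    exact (abs_sub _ _).trans (add_le_add hl h0)
  have h2K : 0 ≤ (2 : ℝ) ^ n * (2 * K) := by positivity
  have hX4 : (2 : ℝ) ^ (n + 1) * (2 * K * Real.exp (-(c / 2 * Real.sqrt (((n + 1 : ℕ) : ℝ))))) +
      2 ^ (n + 1) * (2 * K * Real.exp (-(c / 2 * Real.sqrt (((n + 1 : ℕ) : ℝ))))) =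
      4 * (2 ^ n * (2 * K) * Real.exp (-(c / 2 * Real.sqrt (((n + 1 : ℕ) : ℝ))))) := by ring
  rw [hX4] at h4
  calc |walshSum (fun k => ArithmeticFunction.liouville k) (∅ : Finset (Fin n))|
      ≤ 2 ^ n * (2 * K) * Real.exp (-(c / 2 * Real.sqrt (((n + 1 : ℕ) : ℝ)))) := by linarith
    _ ≤ 2 ^ n * (2 * K) * Real.exp (-(c / 2 * Real.sqrt n)) := mul_le_mul_of_nonneg_left hsq h2K
    _ = 2 * K * Real.exp (-(c / 2 * Real.sqrt n)) * 2 ^ n := by ring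

/-- `|λ(m)| ≤ 1`. [folklore] -/
theorem abs_liouville_le_one (m : ℕ) : |(ArithmeticFunction.liouville m : ℤ)| ≤ 1 := by
  by_cases hm : m = 0
  · subst hm; simp
  · rw [ArithmeticFunction.liouville_apply hm, abs_pow, abs_neg, abs_one, one_pow]

end Green2012

open Green2012

/-- **Green 2012, Theorem 1 from Proposition 1** (the deduction of §2 of the paper, with Tal's
Fourier-tail bound `ACForm.tailWeight_le_tailBound` in place of Linial–Mansour–Nisan and the digit
identity `Green2012.moebius_walshSum_empty_identity` for the constant coefficient): the named fact
`green_moebius_fourierWalsh` (Proposition 1) implies the named fact `green_moebius_ACd` (Theorem 1).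
Constants: `c₁ = min c 1`, then `Green2012.acd_of_walsh_bounds` with `(c₁/2, 6 max(K,1))`.
[cite: Green2012, §2 (proof of Theorem 1 from Proposition 1 and Theorem 2)] -/
theorem green_moebius_ACd_of_fourierWalsh (h : green_moebius_fourierWalsh) : green_moebius_ACd := by
  obtain ⟨c, hc, K, hX⟩ := h
  have hK1 : (1 : ℝ) ≤ max K 1 := le_max_right _ _
  have hK0 : (0 : ℝ) ≤ max K 1 := zero_le_one.trans hK1
  have hc₁0 : 0 < min c 1 := lt_min hc one_pos
  have hX₁ := walsh_bound_mono (min_le_left c 1) hK0 (le_max_left K 1) hX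
  have h0 : ∀ n : ℕ, 2 ≤ n → |walshSum (fun k => ArithmeticFunction.moebius k) (∅ : Finset (Fin n))| / 2 ^ n ≤
      6 * max K 1 * Real.exp (-(min c 1 / 2 * Real.sqrt n)) :=
    fun n hn => moebius_walshSum_empty_le hc₁0.le hK0 hX₁ hn
  have hX₂ := walsh_bound_mono (c₂ := min c 1 / 2) (K₂ := 6 * max K 1) (by linarith) (by linarith)
    (by linarith) hX₁
  exact acd_of_walsh_bounds (fun m => ArithmeticFunction.moebius m)
    (fun m => ArithmeticFunction.abs_moebius_le_one) (by linarith)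
    (by linarith [min_le_right c 1]) (by linarith) hX₂ h0

/-- **Green 2012, Theorem 1 for `λ` from Proposition 1 for `λ`** (same deduction; the constant
coefficient through `Green2012.liouville_walshSum_empty_le`): `green_liouville_fourierWalsh` implies
`green_liouville_ACd`. This is the formal content of the remark in the docstring of
`green_liouville_fourierWalsh` that the arithmetic input is "to be combined with the tree's PROVED
Fourier-tail bounds for `acBasis` circuits … in place of Green's Theorem 2".
[cite: Green2012, §2 and §1 remark on λ] -/
theorem green_liouville_ACd_of_fourierWalsh (h : green_liouville_fourierWalsh) : green_liouville_ACd := by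
  obtain ⟨c, hc, K, hX⟩ := h
  have hK1 : (1 : ℝ) ≤ max K 1 := le_max_right _ _
  have hK0 : (0 : ℝ) ≤ max K 1 := zero_le_one.trans hK1
  have hc₁0 : 0 < min c 1 := lt_min hc one_pos
  have hX₁ := walsh_bound_mono (min_le_left c 1) hK0 (le_max_left K 1) hX
  have h0 : ∀ n : ℕ, 2 ≤ n → |walshSum (fun k => ArithmeticFunction.liouville k) (∅ : Finset (Fin n))| / 2 ^ n ≤
      2 * max K 1 * Real.exp (-(min c 1 / 2 * Real.sqrt n)) :=
    fun n _ => liouville_walshSum_empty_le hc₁0.le hK0 hX₁ n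
  have hX₂ := walsh_bound_mono (c₂ := min c 1 / 2) (K₂ := 2 * max K 1) (by linarith) (by linarith)
    (by linarith) hX₁
  exact acd_of_walsh_bounds (fun m => ArithmeticFunction.liouville m) abs_liouville_le_one (by linarith)
    (by linarith [min_le_right c 1]) (by linarith) hX₂ h0

end Literature.NumberTheory.LFunctions

end
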